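import Literature.IUT.HodgeTheaters.TemperedCoveringsCor23LevelsSub
import HarnessLib

/-!
# [IUTchI] Cor. 2.3 (vi) AT LEVEL `i` BY NAME: the level datum and its agreement with the levels carrier

Mochizuki, *Inter-universal Teichmüller theory I: construction of Hodge theaters*, kurims manuscript (May
2020), §2, Cor. 2.3 (vi) p. 48 ("Let `I_x ⊆ Δ^tp_X` … be an inertia group associated to a cusp `x` of `X` …
Then the following conditions are equivalent: (a) `I_x` lies in a `Δ^tp_X`-conjugate of `Δ^tp_{X,ℍ}`; (b) `ξ`
meets an irreducible component of the special fiber of `𝔛` that is contained in `ℍ`"), applied — as in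
*Inter-universal Teichmüller theory II* §2 Cor. 2.4 (i), proof p. 70 l. −2 – p. 71 l. 1, "to the various
finite index open subgroups of `Δ^±_v`" — to the covering `X_{J_i}` and the component `ℍ̃_i` of the inverse
image of `ℍ` ([IUTchI] Cor 2.3(vi) p.48) [claim: Mochizuki2012, status: disputed] (D-0012 claim key; series
status DISPUTED — nothing of the series is asserted: data, `Prop`-valued predicates on data, theorems about them).

Companion of the sub-DAG statements file `TemperedCoveringsCor23LevelsSub.lean` (p418158; plan/L5/
SUBDAG-IUTchI-Cor23Levels.md row B3 "incidence from `Cor23vi` at level `i` BY NAME", abc-iut-L5-lead RULINGS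
#5 (2); seat abc-iut-L5-t11).  There the sub-node B3 is the predicate `SubgraphLevelData.LevelIncidence`.  Here:
* `SubgraphLevelData.LevelDatum L i` — the [IUTchI] §2 datum of the covering `X_{J_i}` (over a finite
  extension `k_i` of `k` inside `k̄`, chosen so that `G_{k_i}` stabilises `ℍ̃_i` — the standing hypothesis of
  Cor. 2.3, p. 47, for the pair `(X_{J_i}, ℍ̃_i)`), as abc-iut-L5-t1's `StableCurveTemperedData`, TOGETHER WITH its
  agreement with the carrier: `Δ^tp_{X_{J_i}} = J_i ⊆ Δ^tp_X`, the dictionary `Δ^tp_{X_{J_i},ℍ̃_i} = Δ^tp_{X,ℍ} ∩ J_i`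
  (B1), the cusp of `X_{J_i}` under a pro-cusp `t·x̃` with representative inertia group `I_{t·x̃} ∩ J_i`, and
  "meets an irreducible component contained in `ℍ̃_i`" = the vertex incidence of the carrier.  Pure data and
  identification atoms (TODO-merge: the specialisation datum per finite étale cover, abc-iut-L3); nothing
  asserts such a datum exists.
* `SubgraphLevelData.levelIncidence_of_cor23vi` — **B3 BY NAME**: abc-iut-L5-t1's predicate `Cor23vi` for the
  level data, at every level, implies `LevelIncidence` (PROVED: conjugation bookkeeping along `J_i ↪ Δ^tp_X`).
No new Literature FACT; no instance, no notation; nothing here bears on [IUTchIII] Cor. 3.12; typed ≠ discharged.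
-/

namespace Literature.IUT.HodgeTheaters

open Pointwise

universe u

namespace StableCurveTemperedData

variable {D : StableCurveTemperedData.{u}}

namespace Prop24Tower

variable {T : D.Prop24Tower}

namespace SubgraphLevelData

variable (L : T.SubgraphLevelData)

/-- **THE LEVEL-`i` DATUM AND ITS AGREEMENT** ([IUTchII] p. 71 l. 1 "the various finite index open subgroups
of `Δ^±_v`"; [IUTchI] Cor. 2.3 p. 47 for the covering `X_{J_i}`): the §2 datum `lev` of `X_{J_i}` with the
sub-semi-graph `ℍ̃_i ⊆ 𝔾_{J_i}` (typed by abc-iut-L5-t1's `StableCurveTemperedData`), the injection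
`Δ^tp_{X_{J_i}} = J_i ↪ Δ^tp_X` onto the level, the dictionary `Δ^tp_{X_{J_i},ℍ̃_i} = Δ^tp_{X,ℍ} ∩ J_i` (row B1),
for each pro-cusp `t·x̃` of `X` (`x` a cusp, `t ∈ Π^tp_X`) the cusp of `X_{J_i}` under it, whose representative
inertia group is `I_{t·x̃} ∩ J_i = t I_x t⁻¹ ∩ J_i`, and the identification of the atom "the cusp meets an
irreducible component of the special fibre contained in `ℍ̃_i`" with the vertex incidence
`t · (vertex of x̃) ∈ ℍ̃_i` of the carrier.  Data + identification atoms; asserted for no instance.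
[cite: Mochizuki2012, Cor 2.3(vi) p.48] -/
structure LevelDatum (i : T.I) : Type (u + 1) where
  /-- the [IUTchI] §2 datum of `X_{J_i}` (over `k_i`, with `G_{k_i}` stabilising `ℍ̃_i`) and `ℍ̃_i ⊆ 𝔾_{J_i}` -/
  lev : StableCurveTemperedData.{u}
  /-- `Δ^tp_{X_{J_i}} ↪ Δ^tp_X` -/
  e : lev.DeltaTp →* D.DeltaTp
  /-- it is injective -/
  e_injective : Function.Injective e
  /-- its image is the level `J_i` -/
  range_e : e.range = D.levelTp (T.Jhat i)
  /-- dictionary (B1): `Δ^tp_{X_{J_i},ℍ̃_i} = Δ^tp_{X,ℍ} ∩ J_i` -/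
  map_deltaTpH : lev.deltaTpH.map e = D.deltaTpH ⊓ D.levelTp (T.Jhat i)
  /-- the cusp of `X_{J_i}` lying under the pro-cusp `t·x̃` -/
  cuspOf : D.Cusp → D.PiTp → lev.Cusp
  /-- its representative inertia group is `t I_x t⁻¹ ∩ J_i` -/
  inertia_cuspOf : ∀ (x : D.Cusp) (t : D.PiTp),
    ((lev.inertiaTp (cuspOf x t)).map e).map D.DeltaTp.subtype =
      MulAut.conj t • ((D.inertiaTp x).map D.DeltaTp.subtype) ⊓ (D.levelTp (T.Jhat i)).map D.DeltaTp.subtype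
  /-- "meets an irreducible component contained in `ℍ̃_i`" is the vertex incidence of the carrier -/
  cuspMeetsH_iff : ∀ (x : D.Cusp) (t : D.PiTp),
    lev.cuspMeetsH (cuspOf x t) ↔ L.act i t (L.vtxCusp i x) ∈ L.compH i

/-- **B3 BY NAME**: abc-iut-L5-t1's Cor. 2.3 (vi) predicate `Cor23vi` for the level data (its tempered clause,
direction (a) ⇒ (b)) gives the sub-node `LevelIncidence` — "by applying the equivalence of [IUTchI], Corollary 2.3,
(vi) … to the various finite index open subgroups of `Δ^±_v`" ([IUTchII] p. 70 l. −2 – p. 71 l. 1).  PROVED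
(conjugation bookkeeping along `J_i ↪ Δ^tp_X`). [cite: Mochizuki2012, Cor 2.3(vi) p.48] -/
theorem levelIncidence_of_cor23vi (A : ∀ i, L.LevelDatum i) (h : ∀ i, (A i).lev.Cor23vi) :
    L.LevelIncidence := by
  intro i x t hyp
  obtain ⟨j, hj, hle⟩ := hyp
  rw [← (A i).cuspMeetsH_iff x t]
  refine ((h i).tp ((A i).cuspOf x t)).mp ?_
  -- the conjugating element `j ∈ J_i` comes from `Δ^tp_{X_{J_i}}`
  obtain ⟨j₀, hj₀, rfl⟩ := hj
  have hj₀' : j₀ ∈ (A i).e.range := by rw [(A i).range_e]; exact hj₀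
  obtain ⟨d, rfl⟩ := hj₀'
  refine ⟨d, fun y hy => ?_⟩
  -- push `y ∈ I` through `e` and `Δ^tp_X ↪ Π^tp_X`
  have h1 : (((A i).e y : D.DeltaTp) : D.PiTp) ∈
      (((A i).lev.inertiaTp ((A i).cuspOf x t)).map (A i).e).map D.DeltaTp.subtype :=
    ⟨(A i).e y, ⟨y, hy, rfl⟩, rfl⟩
  rw [(A i).inertia_cuspOf x t] at h1
  have h2 := hle h1
  rw [Subgroup.mem_smul_pointwise_iff_exists] at h2
  obtain ⟨_, ⟨z, hz, rfl⟩, hzy⟩ := h2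
  -- `z ∈ Δ^tp_{X,ℍ} ∩ J_i = e(Δ^tp_{X_{J_i},ℍ̃_i})`
  rw [← (A i).map_deltaTpH] at hz
  obtain ⟨w, hw, rfl⟩ := hz
  -- `(e d) (e w) (e d)⁻¹ = e y`, hence `y = d w d⁻¹`
  have heq : (A i).e (d * w * d⁻¹) = (A i).e y := by
    apply Subtype.ext
    rw [MulAut.smul_def, MulAut.conj_apply] at hzy
    simpa only [map_mul, map_inv, Subgroup.coe_mul, Subgroup.coe_inv, Subgroup.coe_subtype] using hzy
  rw [← (A i).e_injective heq]
  simpa only [MulAut.smul_def, MulAut.conj_apply] using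
    Subgroup.smul_mem_pointwise_smul _ (MulAut.conj d) _ hw

/-- **B4-L5 with B3 by name**: the per-level target from base Cor. 2.3 (i), Cor. 2.3 (vi) for the level data,
the block property and the dictionary B1 (c). [cite: Mochizuki2012, Cor 2.3(vi) p.48] -/
theorem levelTarget_of_cor23vi (A : ∀ i, L.LevelDatum i) (h23i : D.Cor23i) (h : ∀ i, (A i).lev.Cor23vi)
    (hblk : L.IsBlock) (hstab : L.StabLeDeltaHLevel) : T.LevelTarget :=
  L.levelTarget_of_inputs h23i (L.levelIncidence_of_cor23vi A h) hblk hstab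

end SubgraphLevelData

end Prop24Tower

end StableCurveTemperedData

end Literature.IUT.HodgeTheaters
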